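import Mathlib
import HarnessLib
import Summits.NavierStokesRegularity.NavierStokesRegularity.Theorems.PoloidalWindowDoorLrcModEntireJetLetters

/-!
# Route `PoloidalWindowDoor`, item `LrcModEntire` (stmt-NavierStokesRegularity-20428) — THE JET LETTERS OF THE LOCAL (TH) SYSTEM
# (wiring, part 1: letters, their analytic realisation from the stub's data, derivative tables, and the dictionary)

Cell ns-regularity-ideate, seat ns-poloidal-K2-p3 gen 7 (lead of item 20428; `--supports stmt-NavierStokesRegularity-20428`; definitions reviewed).
The registered stub `stub_localTHEmpty` quantifies over real-analytic `u : ℝ → ℝ³ → ℝ³` on an open space–time set `U ∋ p₀` and real-analytic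
slope/pressure data `μ, A : ℝ → ℝ → ℝ` of `(time, height)`.  An exact elimination certificate (`…JetCertTree.checkTree`) speaks about
LETTERS; this file fixes the letter alphabet of the (TH) system and realises each letter as an analytic function of the stub's data:

* `THLetter`: `W i a b c d` = `∂ₜᵃ∂ₓᵇ∂_yᶜ∂_zᵈ u_i` (`i = 0,1,2`), `M a d` = `∂ₜᵃ∂_zᵈ μ`, `A a d` = `∂ₜᵃ∂_zᵈ A` (read at the shadow point
  `(t, y₂)`); `THLetter.shift j` = the letter of the derivative along direction `j` (`0 = t, 1 = x, 2 = y, 3 = z`; `none` = the derivative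
  is identically zero: `M`, `A` along `x, y`, or an unused direction);
* `dirVec j` (the four coordinate directions of `ℝ × ℝ³`), `wordW a b c d`, `word2 a d` (words of directions) and the permutation lemmas
  `perm_dirVec_cons_wordW`, `perm_cons_word2` (differentiating a sorted word re-sorts);
* `letterFn u μ A ℓ` — the realisation (`jetLetter` along the word; shadow-composed for `M`, `A`), `analyticSet μ` = `{q | AnalyticAt (uncurry μ) q}`
  (open), `differentiableAt_letterFn`, and THE TABLE THEOREM `fderiv_letterFn_shift` / `fderiv_letterFn_none`:
  `D(letterFn ℓ)(p)(dirVec j) = letterFn ℓ' p` when `ℓ.shift j = some ℓ'`, `= 0` when `ℓ.shift j = none` (`p ∈ U`);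
* THE DICTIONARY (`letterFn_W0`, `letterFn_W_space`, `letterFn_W_time`, `letterFn_W_space_space`, `letterFn_M00`, `letterFn_M10`,
  `letterFn_M01`, `letterFn_M02`, `letterFn_A00`): the low letters ARE the slice quantities appearing in `stub_localTHEmpty`
  (`u p.1 p.2 i`, `fderiv ℝ (u p.1) p.2 (eⱼ) i`, `deriv (fun s => u s p.2 i) p.1`, `fderiv ℝ (fun y => fderiv ℝ (u p.1) y (e_k) 2) p.2 (e_j)`,
  `μ p.1 (p.2 2)`, `deriv (fun s => μ s c) t`, `deriv (μ t) c`, `deriv (deriv (μ t)) c`, `A`).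
Part 2 (`…LrcModEntireTHCert`) turns a letter LIST into the jet map, tables, the five base laws and four pins as term lists, and proves
`stub_localTHEmpty` from `checkTree … = true`.

WHAT THIS IS NOT: not a claim about Navier–Stokes and not a certificate — wiring (bears_on LADDER-NS N0, item 20428 `stub_localTHEmpty`). [folklore]
-/

noncomputable section

-- the summit and its single sub-problem share the name (CONVENTIONS §1), as in every Theorems file
set_option linter.dupNamespace false

namespace Summit.NavierStokesRegularity.NavierStokesRegularity.Theorems.PoloidalWindowDoorLrcModEntireTHCertLetters

open _root_.Topology _root_.Filter Set Function
open Summit.NavierStokesRegularity.NavierStokesRegularity.Theorems.PoloidalWindowDoorLrcModEntireJetLetters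

/-! ### The alphabet -/

/-- The letters of the local (TH) system: `W i a b c d = ∂ₜᵃ∂ₓᵇ∂_yᶜ∂_zᵈ u_i`, `M a d = ∂ₜᵃ∂_zᵈ μ`, `A a d = ∂ₜᵃ∂_zᵈ A`. [folklore] -/
inductive THLetter : Type
  | W : Fin 3 → ℕ → ℕ → ℕ → ℕ → THLetter
  | M : ℕ → ℕ → THLetter
  | A : ℕ → ℕ → THLetter
  deriving DecidableEq

/-- The letter of the derivative along direction `j` (`0 = t, 1 = x, 2 = y, 3 = z`); `none` = identically zero derivative. [folklore] -/
def THLetter.shift : ℕ → THLetter → Option THLetter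
  | 0, .W i a b c d => some (.W i (a + 1) b c d)
  | 1, .W i a b c d => some (.W i a (b + 1) c d)
  | 2, .W i a b c d => some (.W i a b (c + 1) d)
  | 3, .W i a b c d => some (.W i a b c (d + 1))
  | 0, .M a d => some (.M (a + 1) d)
  | 3, .M a d => some (.M a (d + 1))
  | 0, .A a d => some (.A (a + 1) d)
  | 3, .A a d => some (.A a (d + 1))
  | _, _ => none

/-! ### Directions and words -/

/-- The four coordinate directions of space–time `ℝ × ℝ³` (`0 = t`, `1,2,3 = x,y,z`); `0` beyond. [folklore] -/
def dirVec : ℕ → ℝ × EuclideanSpace ℝ (Fin 3)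
  | 0 => (1, 0)
  | 1 => (0, EuclideanSpace.single 0 1)
  | 2 => (0, EuclideanSpace.single 1 1)
  | 3 => (0, EuclideanSpace.single 2 1)
  | _ => 0

/-- The sorted word `tᵃ xᵇ yᶜ zᵈ` of space–time directions. [folklore] -/
def wordW (a b c d : ℕ) : List (ℝ × EuclideanSpace ℝ (Fin 3)) :=
  List.replicate a (dirVec 0) ++ List.replicate b (dirVec 1) ++ List.replicate c (dirVec 2) ++ List.replicate d (dirVec 3)

/-- The sorted word `tᵃ zᵈ` of `(time, height)` directions. [folklore] -/
def word2 (a d : ℕ) : List (ℝ × ℝ) := List.replicate a (1, 0) ++ List.replicate d (0, 1)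

/-- Prepending `t` to `tᵃxᵇyᶜzᵈ` re-sorts to `tᵃ⁺¹xᵇyᶜzᵈ`. [folklore] -/
theorem perm_wordW_t (a b c d : ℕ) : (dirVec 0 :: wordW a b c d).Perm (wordW (a + 1) b c d) := by
  simp [wordW, List.replicate_succ]

/-- Prepending `x` re-sorts. [folklore] -/
theorem perm_wordW_x (a b c d : ℕ) : (dirVec 1 :: wordW a b c d).Perm (wordW a (b + 1) c d) := by
  rw [wordW, wordW, List.replicate_succ, List.append_assoc, List.append_assoc, List.append_assoc, List.append_assoc]
  exact List.perm_middle.symm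

/-- Prepending `y` re-sorts. [folklore] -/
theorem perm_wordW_y (a b c d : ℕ) : (dirVec 2 :: wordW a b c d).Perm (wordW a b (c + 1) d) := by
  have h : wordW a b (c + 1) d = (List.replicate a (dirVec 0) ++ List.replicate b (dirVec 1)) ++
      dirVec 2 :: (List.replicate c (dirVec 2) ++ List.replicate d (dirVec 3)) := by
    simp [wordW, List.replicate_succ, List.append_assoc]
  have h' : dirVec 2 :: wordW a b c d = dirVec 2 :: ((List.replicate a (dirVec 0) ++ List.replicate b (dirVec 1)) ++
      (List.replicate c (dirVec 2) ++ List.replicate d (dirVec 3))) := by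
    simp [wordW, List.append_assoc]
  rw [h, h']
  exact List.perm_middle.symm

/-- Prepending `z` re-sorts. [folklore] -/
theorem perm_wordW_z (a b c d : ℕ) : (dirVec 3 :: wordW a b c d).Perm (wordW a b c (d + 1)) := by
  have h : wordW a b c (d + 1) = (List.replicate a (dirVec 0) ++ List.replicate b (dirVec 1) ++ List.replicate c (dirVec 2)) ++
      dirVec 3 :: List.replicate d (dirVec 3) := by
    simp [wordW, List.replicate_succ, List.append_assoc]
  have h' : dirVec 3 :: wordW a b c d = dirVec 3 :: ((List.replicate a (dirVec 0) ++ List.replicate b (dirVec 1) ++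
      List.replicate c (dirVec 2)) ++ List.replicate d (dirVec 3)) := by
    simp [wordW, List.append_assoc]
  rw [h, h']
  exact List.perm_middle.symm

/-- Prepending `(1,0)` to `tᵃzᵈ` re-sorts. [folklore] -/
theorem perm_word2_t (a d : ℕ) : (((1 : ℝ), (0 : ℝ)) :: word2 a d).Perm (word2 (a + 1) d) := by
  simp [word2, List.replicate_succ]

/-- Prepending `(0,1)` to `tᵃzᵈ` re-sorts. [folklore] -/
theorem perm_word2_z (a d : ℕ) : (((0 : ℝ), (1 : ℝ)) :: word2 a d).Perm (word2 a (d + 1)) := by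
  rw [word2, word2, List.replicate_succ]
  exact List.perm_middle.symm

/-! ### Realisation of the letters -/

/-- The realisation of a letter from the data `(u, μ, A)`. [folklore] -/
def letterFn (u : ℝ → EuclideanSpace ℝ (Fin 3) → EuclideanSpace ℝ (Fin 3)) (μ A : ℝ → ℝ → ℝ) :
    THLetter → (ℝ × EuclideanSpace ℝ (Fin 3) → ℝ)
  | .W i a b c d => jetLetter (fun p : ℝ × EuclideanSpace ℝ (Fin 3) => u p.1 p.2 i) (wordW a b c d)
  | .M a d => fun p => jetLetter (uncurry μ) (word2 a d) (p.1, p.2 2)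
  | .A a d => fun p => jetLetter (uncurry A) (word2 a d) (p.1, p.2 2)

/-- The open set where a datum of two variables is analytic. [folklore] -/
def analyticSet (μ : ℝ → ℝ → ℝ) : Set (ℝ × ℝ) := {q | AnalyticAt ℝ (uncurry μ) q}

/-- [folklore] -/
theorem isOpen_analyticSet (μ : ℝ → ℝ → ℝ) : IsOpen (analyticSet μ) := isOpen_analyticAt ℝ (uncurry μ)

/-- [folklore] -/
theorem analyticOnNhd_analyticSet (μ : ℝ → ℝ → ℝ) : AnalyticOnNhd ℝ (uncurry μ) (analyticSet μ) := fun _ hq => hq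

section Data

variable {u : ℝ → EuclideanSpace ℝ (Fin 3) → EuclideanSpace ℝ (Fin 3)} {μ A : ℝ → ℝ → ℝ}
  {U : Set (ℝ × EuclideanSpace ℝ (Fin 3))}

/-- The components of an analytic velocity are analytic on `U`. [folklore] -/
theorem analyticOnNhd_comp (hu : AnalyticOnNhd ℝ (uncurry u) U) (i : Fin 3) :
    AnalyticOnNhd ℝ (fun p : ℝ × EuclideanSpace ℝ (Fin 3) => u p.1 p.2 i) U := by
  have h : (fun p : ℝ × EuclideanSpace ℝ (Fin 3) => u p.1 p.2 i) =
      (EuclideanSpace.proj i : EuclideanSpace ℝ (Fin 3) →L[ℝ] ℝ) ∘ uncurry u := by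
    funext p; rfl
  rw [h]
  exact (EuclideanSpace.proj i).comp_analyticOnNhd hu

/-- **Every letter is differentiable at the points of `U`** (velocity letters: analytic on `U`; data letters: analytic on the open
analytic set of the datum, which contains the shadow of `U`). [folklore] -/
theorem differentiableAt_letterFn (hu : AnalyticOnNhd ℝ (uncurry u) U)
    (hμ : ∀ p ∈ U, AnalyticAt ℝ (uncurry μ) (p.1, p.2 2)) (hA : ∀ p ∈ U, AnalyticAt ℝ (uncurry A) (p.1, p.2 2))
    (ℓ : THLetter) {p : ℝ × EuclideanSpace ℝ (Fin 3)} (hp : p ∈ U) : DifferentiableAt ℝ (letterFn u μ A ℓ) p := by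
  cases ℓ with
  | W i a b c d => exact differentiableAt_jetLetter (analyticOnNhd_comp hu i) _ hp
  | M a d =>
    exact differentiableAt_comp_timeHeight
      ((analyticOnNhd_jetLetter (analyticOnNhd_analyticSet μ) (word2 a d) _ (hμ p hp)).differentiableAt)
  | A a d =>
    exact differentiableAt_comp_timeHeight
      ((analyticOnNhd_jetLetter (analyticOnNhd_analyticSet A) (word2 a d) _ (hA p hp)).differentiableAt)

/-- **THE TABLE THEOREM, shift case**: along direction `j`, the derivative of the letter `ℓ` is the letter `ℓ.shift j` (on `U`). [folklore] -/
theorem fderiv_letterFn_shift (hU : IsOpen U) (hu : AnalyticOnNhd ℝ (uncurry u) U)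
    (hμ : ∀ p ∈ U, AnalyticAt ℝ (uncurry μ) (p.1, p.2 2)) (hA : ∀ p ∈ U, AnalyticAt ℝ (uncurry A) (p.1, p.2 2))
    {ℓ ℓ' : THLetter} {j : ℕ} (hs : ℓ.shift j = some ℓ') {p : ℝ × EuclideanSpace ℝ (Fin 3)} (hp : p ∈ U) :
    fderiv ℝ (letterFn u μ A ℓ) p (dirVec j) = letterFn u μ A ℓ' p := by
  cases ℓ with
  | W i a b c d =>
    have hF := analyticOnNhd_comp hu i
    match j, hs with
    | 0, hs => simp only [THLetter.shift, Option.some.injEq] at hs; subst hs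
               exact fderiv_jetLetter_of_perm hU hF (perm_wordW_t a b c d) hp
    | 1, hs => simp only [THLetter.shift, Option.some.injEq] at hs; subst hs
               exact fderiv_jetLetter_of_perm hU hF (perm_wordW_x a b c d) hp
    | 2, hs => simp only [THLetter.shift, Option.some.injEq] at hs; subst hs
               exact fderiv_jetLetter_of_perm hU hF (perm_wordW_y a b c d) hp
    | 3, hs => simp only [THLetter.shift, Option.some.injEq] at hs; subst hs
               exact fderiv_jetLetter_of_perm hU hF (perm_wordW_z a b c d) hp
    | (k + 4), hs => simp [THLetter.shift] at hs
  | M a d =>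
    have hG : DifferentiableAt ℝ (jetLetter (uncurry μ) (word2 a d)) (p.1, p.2 2) :=
      (analyticOnNhd_jetLetter (analyticOnNhd_analyticSet μ) (word2 a d) _ (hμ p hp)).differentiableAt
    match j, hs with
    | 0, hs =>
      simp only [THLetter.shift, Option.some.injEq] at hs; subst hs
      show fderiv ℝ (fun q : ℝ × EuclideanSpace ℝ (Fin 3) => jetLetter (uncurry μ) (word2 a d) (q.1, q.2 2)) p (1, 0) = _
      rw [fderiv_comp_timeHeight hG]
      exact fderiv_jetLetter_of_perm (isOpen_analyticSet μ) (analyticOnNhd_analyticSet μ) (perm_word2_t a d) (hμ p hp)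
    | 3, hs =>
      simp only [THLetter.shift, Option.some.injEq] at hs; subst hs
      show fderiv ℝ (fun q : ℝ × EuclideanSpace ℝ (Fin 3) => jetLetter (uncurry μ) (word2 a d) (q.1, q.2 2)) p
        (0, EuclideanSpace.single 2 1) = _
      rw [fderiv_comp_timeHeight hG, show (EuclideanSpace.single (2 : Fin 3) (1 : ℝ) : EuclideanSpace ℝ (Fin 3)) 2 = 1 by simp]
      exact fderiv_jetLetter_of_perm (isOpen_analyticSet μ) (analyticOnNhd_analyticSet μ) (perm_word2_z a d) (hμ p hp)
    | 1, hs => simp [THLetter.shift] at hs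
    | 2, hs => simp [THLetter.shift] at hs
    | (k + 4), hs => simp [THLetter.shift] at hs
  | A a d =>
    have hG : DifferentiableAt ℝ (jetLetter (uncurry A) (word2 a d)) (p.1, p.2 2) :=
      (analyticOnNhd_jetLetter (analyticOnNhd_analyticSet A) (word2 a d) _ (hA p hp)).differentiableAt
    match j, hs with
    | 0, hs =>
      simp only [THLetter.shift, Option.some.injEq] at hs; subst hs
      show fderiv ℝ (fun q : ℝ × EuclideanSpace ℝ (Fin 3) => jetLetter (uncurry A) (word2 a d) (q.1, q.2 2)) p (1, 0) = _
      rw [fderiv_comp_timeHeight hG]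
      exact fderiv_jetLetter_of_perm (isOpen_analyticSet A) (analyticOnNhd_analyticSet A) (perm_word2_t a d) (hA p hp)
    | 3, hs =>
      simp only [THLetter.shift, Option.some.injEq] at hs; subst hs
      show fderiv ℝ (fun q : ℝ × EuclideanSpace ℝ (Fin 3) => jetLetter (uncurry A) (word2 a d) (q.1, q.2 2)) p
        (0, EuclideanSpace.single 2 1) = _
      rw [fderiv_comp_timeHeight hG, show (EuclideanSpace.single (2 : Fin 3) (1 : ℝ) : EuclideanSpace ℝ (Fin 3)) 2 = 1 by simp]
      exact fderiv_jetLetter_of_perm (isOpen_analyticSet A) (analyticOnNhd_analyticSet A) (perm_word2_z a d) (hA p hp)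
    | 1, hs => simp [THLetter.shift] at hs
    | 2, hs => simp [THLetter.shift] at hs
    | (k + 4), hs => simp [THLetter.shift] at hs

/-- **THE TABLE THEOREM, zero case**: if `ℓ.shift j = none`, the derivative of the letter along `dirVec j` vanishes (on `U`). [folklore] -/
theorem fderiv_letterFn_none
    (hμ : ∀ p ∈ U, AnalyticAt ℝ (uncurry μ) (p.1, p.2 2)) (hA : ∀ p ∈ U, AnalyticAt ℝ (uncurry A) (p.1, p.2 2))
    {ℓ : THLetter} {j : ℕ} (hs : ℓ.shift j = none) {p : ℝ × EuclideanSpace ℝ (Fin 3)} (hp : p ∈ U) :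
    fderiv ℝ (letterFn u μ A ℓ) p (dirVec j) = 0 := by
  -- directions ≥ 4 are the zero vector
  by_cases hj : 4 ≤ j
  · obtain ⟨k, rfl⟩ := Nat.exists_eq_add_of_le hj
    have : dirVec (4 + k) = 0 := by
      rw [show 4 + k = k + 4 from Nat.add_comm 4 k]; rfl
    rw [this, map_zero]
  · push Not at hj
    cases ℓ with
    | W i a b c d => interval_cases j <;> simp [THLetter.shift] at hs
    | M a d =>
      have hG : DifferentiableAt ℝ (jetLetter (uncurry μ) (word2 a d)) (p.1, p.2 2) :=
        (analyticOnNhd_jetLetter (analyticOnNhd_analyticSet μ) (word2 a d) _ (hμ p hp)).differentiableAt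
      interval_cases j
      · simp [THLetter.shift] at hs
      · show fderiv ℝ (fun q : ℝ × EuclideanSpace ℝ (Fin 3) => jetLetter (uncurry μ) (word2 a d) (q.1, q.2 2)) p
          (0, EuclideanSpace.single 0 1) = 0
        rw [fderiv_comp_timeHeight hG]; simp [Prod.mk_zero_zero]
      · show fderiv ℝ (fun q : ℝ × EuclideanSpace ℝ (Fin 3) => jetLetter (uncurry μ) (word2 a d) (q.1, q.2 2)) p
          (0, EuclideanSpace.single 1 1) = 0
        rw [fderiv_comp_timeHeight hG]; simp [Prod.mk_zero_zero]
      · simp [THLetter.shift] at hs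
    | A a d =>
      have hG : DifferentiableAt ℝ (jetLetter (uncurry A) (word2 a d)) (p.1, p.2 2) :=
        (analyticOnNhd_jetLetter (analyticOnNhd_analyticSet A) (word2 a d) _ (hA p hp)).differentiableAt
      interval_cases j
      · simp [THLetter.shift] at hs
      · show fderiv ℝ (fun q : ℝ × EuclideanSpace ℝ (Fin 3) => jetLetter (uncurry A) (word2 a d) (q.1, q.2 2)) p
          (0, EuclideanSpace.single 0 1) = 0
        rw [fderiv_comp_timeHeight hG]; simp [Prod.mk_zero_zero]
      · show fderiv ℝ (fun q : ℝ × EuclideanSpace ℝ (Fin 3) => jetLetter (uncurry A) (word2 a d) (q.1, q.2 2)) p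
          (0, EuclideanSpace.single 1 1) = 0
        rw [fderiv_comp_timeHeight hG]; simp [Prod.mk_zero_zero]
      · simp [THLetter.shift] at hs

end Data

end Summit.NavierStokesRegularity.NavierStokesRegularity.Theorems.PoloidalWindowDoorLrcModEntireTHCertLetters

end
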